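import Mathlib
import Summits.Parity.BatemanHorn.Theses.PolynomialMobius
import Summits.Parity.BatemanHorn.Theorems.IsogenyRedeiPolyMobiusTailStubDegreeOneSlice
import Literature.NumberTheory.Sieve.BatemanHornProofs

/-!
# Crux `PolyMobiusTail` (stmt-Parity-0870), registered skeleton `Lines/stub_window_linear_le_one.lean`:
# stub P1 `stub_degreeOne_tail` — the Möbius tail of a ONE-member linear system is `o(x)` at every `η`

For a Bateman–Horn system `f = (f₀)` with `deg f₀ ≤ 1` and every `0 < η < 1`,

  `Σ_{n ≤ x} Σ_{d ∣ f₀(n), x^{1-η} < d} μ(d) log d = o(x)`.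

A Bateman–Horn member is non-constant (`IsBatemanHornSystem.natDegree_pos`: a positive irreducible
constant would be a fixed prime divisor), so `deg f₀ = 1`, and the statement is the landed degree-one
slice `NaturalForm.stub_degreeOneSlice` (p114749: PNT for `Λ` in progressions minus the Type-I main term).
-/

open scoped BigOperators
open Filter Finset Polynomial Asymptotics

namespace Summit.Parity.BatemanHorn.Theorems.PolyMobiusTail.EtaFreeWindow

open Literature.NumberTheory.Sieve

/-- **Stub P1 `stub_degreeOne_tail` (registered skeleton `Lines/stub_window_linear_le_one.lean` of crux
stmt-Parity-0870).** For a one-member Bateman–Horn system `f = (f₀)` with `deg f₀ ≤ 1` and every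
`η ∈ (0,1)`, the full Möbius tail at cut `x^{1-η}` is `o(x)`:
`Σ_{n≤x} Σ_{d ∣ f₀(n), x^{1-η} < d} μ(d) log d = o(x)`.
Degree `0` is excluded by the Bateman–Horn axioms (`IsBatemanHornSystem.natDegree_pos`), so this is the
landed degree-one slice `NaturalForm.stub_degreeOneSlice` (prime number theorem for `Λ` in arithmetic
progressions minus the Type-I main term `C(f)·x`, `C(f) = q/φ(q)`). [folklore reduction] -/
theorem stub_degreeOne_tail : ∀ (f : Fin 1 → ℤ[X]), IsBatemanHornSystem f → (f 0).natDegree ≤ 1 →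
    ∀ η : ℝ, 0 < η → η < 1 →
      (fun x : ℕ => ∑ n ∈ Finset.Icc 1 x,
        ∑ d ∈ Fintype.piFinset (fun i => (((f i).eval (n : ℤ)).toNat).divisors),
          if (x : ℝ) ^ (1 - η) < ∏ i, (d i : ℝ) then
            ∏ i, ((ArithmeticFunction.moebius (d i) : ℝ) * Real.log (d i)) else 0)
        =o[atTop] fun x : ℕ => (x : ℝ) :=
  fun f hf hd => NaturalForm.stub_degreeOneSlice f hf (le_antisymm hd (hf.natDegree_pos 0))

end Summit.Parity.BatemanHorn.Theorems.PolyMobiusTail.EtaFreeWindow
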